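import Mathlib.Analysis.Calculus.FDeriv.Symmetric
import Mathlib.Analysis.InnerProductSpace.PiL2
import Mathlib.Analysis.InnerProductSpace.Trace
import Literature.Geometry.Lorentzian.ChartCalculus
import Literature.Geometry.Lorentzian.CurvatureLinearizationAlgebra
import HarnessLib

/-!
# Linearisation of the scalar curvature at the flat metric, in an orthonormal frame

Support file (all results proved) for Bartnik's existence theorem for the ADM energy
(`Literature.Geometry.Lorentzian.AFEnd.HasADMEnergy_of_isAsymptoticallyFlat`). For the
components `G : E → (E →L E →L ℝ)` of a metric on a real inner product space `E` with orthonormal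
basis `b` (Gram matrix `𝒢ᵢⱼ = G x bᵢ bⱼ`, Koszul form `K = koszulForm G`), the coordinate
expression of the scalar curvature (`OpensChart.scalarCurvature_eq_coord`) is compared with its
linearisation at `δ`,

  `L(x) = ∑ᵢₖ (∂ᵢ∂ₖ Gᵢₖ − ∂ᵢ∂ᵢ Gₖₖ)(x)`,

which is the divergence of the ADM flux field `Vᵢ = ∑ⱼ (∂ⱼ Gᵢⱼ − ∂ᵢ Gⱼⱼ)` (Arnowitt–Deser–Misner;
Bartnik 1986, (4.2)): `|S_coord(x) − L(x)| ≤ C₁ ‖G x − δ‖ ‖D²G(x)‖ + C₂ ‖DG(x)‖²` as soon as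
`‖G x − δ‖ ≤ 1/(2 dim E)` (Bartnik 1986, (4.3)–(4.4); Lee, *Geometric Relativity*, Ch. 3).

* `fderiv_apply₃`, `fderiv_fderiv_bilin_apply_eq`, `fderiv_koszulForm_eq` — calculus of the components
  (evaluation commutes with differentiation);
* `abs_scalarCoord_sub_linKoszul_le` — the estimate with the linear part in Koszul form
  (`CurvatureLinearizationAlgebra`);
* `linKoszul_eq_sum` — the linear part equals `L(x)` (symmetry of second derivatives and of `G`);
* `hasFDerivAt_admVec`, `trace_fderiv_admVec`, `contDiffAt_admVec` — the ADM flux field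
  `V = ∑ᵢ (∑ⱼ (∂ⱼ Gᵢⱼ − ∂ᵢ Gⱼⱼ)) bᵢ` (given through a representative hypothesis) has
  `div V = tr DV = L`.

## References

* R. Bartnik, *The mass of an asymptotically flat manifold*, CPAM 39 (1986), §4, (4.2)–(4.4).
* R. Arnowitt, S. Deser, C. W. Misner, *The dynamics of general relativity* (1962).
* D. A. Lee, *Geometric Relativity* (2019), Ch. 3, §3.1 (ADM energy and its well-definedness).
-/

noncomputable section

-- instance search on the nested operator spaces `E →L[ℝ] E →L[ℝ] E →L[ℝ] ℝ` (second derivatives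
-- of the metric components) needs a deeper pending depth, as in Mathlib's own build options
set_option maxSynthPendingDepth 3

open Finset Filter ContinuousLinearMap
open scoped Topology RealInnerProductSpace ContDiff

namespace Literature.Geometry.Lorentzian

/-! ### Evaluation commutes with differentiation -/

section Calculus

variable {E : Type*} [NormedAddCommGroup E] [NormedSpace ℝ E]

/-- `∂_z (H(·) u v w)(x) = DH(x)(z)(u)(v)(w)` for a differentiable family of trilinear forms.
[folklore] -/
theorem fderiv_apply₃ {H : E → E →L[ℝ] E →L[ℝ] E →L[ℝ] ℝ} {x : E} (hH : DifferentiableAt ℝ H x)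
    (u v w z : E) : fderiv ℝ (fun y ↦ H y u v w) x z = fderiv ℝ H x z u v w := by
  have h1 : DifferentiableAt ℝ (fun y ↦ H y u) x := hH.clm_apply (differentiableAt_const u)
  have h2 : DifferentiableAt ℝ (fun y ↦ H y u v) x := h1.clm_apply (differentiableAt_const v)
  rw [fderiv_clm_apply h2 (differentiableAt_const w), fderiv_clm_apply h1 (differentiableAt_const v),
    fderiv_clm_apply hH (differentiableAt_const u)]
  simp only [fderiv_fun_const, Pi.zero_apply, ContinuousLinearMap.comp_zero, zero_add,
    ContinuousLinearMap.flip_apply]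

variable {G : E → E →L[ℝ] E →L[ℝ] ℝ} {x : E}

/-- Near a `C²` point the components are differentiable. [folklore] -/
theorem eventually_differentiableAt_of_contDiffAt_two (hG2 : ContDiffAt ℝ 2 G x) :
    ∀ᶠ y in 𝓝 x, DifferentiableAt ℝ G y :=
  (hG2.eventually (by simp)).mono fun _ hy ↦ hy.differentiableAt (by norm_num)

/-- At a `C²` point the derivative `DG` is differentiable. [folklore] -/
theorem differentiableAt_fderiv_of_contDiffAt_two (hG2 : ContDiffAt ℝ 2 G x) :
    DifferentiableAt ℝ (fderiv ℝ G) x :=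
  (hG2.fderiv_right (m := 1) le_rfl).differentiableAt one_ne_zero

/-- **Second derivatives of the components are components of the second derivative**: at a
`C²` point, `D²G(x)(a)(u)(v)(w) = ∂ₐ(∂ᵤ G(·)(v)(w))(x)`. [folklore] -/
theorem fderiv_fderiv_bilin_apply_eq (hG2 : ContDiffAt ℝ 2 G x) (a u v w : E) :
    fderiv ℝ (fderiv ℝ G) x a u v w = fderiv ℝ (fun y ↦ fderiv ℝ (fun z ↦ G z v w) y u) x a := by
  have heq : (fun y ↦ fderiv ℝ (fun z ↦ G z v w) y u) =ᶠ[𝓝 x] fun y ↦ fderiv ℝ G y u v w :=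
    (eventually_differentiableAt_of_contDiffAt_two hG2).mono fun y hy ↦ by
      dsimp only
      rw [OpensChart.fderiv_apply₂ G hy v w u]
  rw [heq.fderiv_eq]
  exact (fderiv_apply₃ (differentiableAt_fderiv_of_contDiffAt_two hG2) u v w a).symm

/-- The component functions `y ↦ ∂ᵤ G(·)(v)(w) (y)` are differentiable at a `C²` point, with
`∂ₐ` equal to `D²G(x)(a)(u)(v)(w)`. [folklore] -/
theorem hasFDerivAt_fderiv_apply₂ (hG2 : ContDiffAt ℝ 2 G x) (u v w : E) :
    HasFDerivAt (fun y ↦ fderiv ℝ (fun z ↦ G z v w) y u)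
      (((fderiv ℝ (fderiv ℝ G) x).flip u).flip v |>.flip w) x := by
  have heq : (fun y ↦ fderiv ℝ (fun z ↦ G z v w) y u) =ᶠ[𝓝 x] fun y ↦ fderiv ℝ G y u v w :=
    (eventually_differentiableAt_of_contDiffAt_two hG2).mono fun y hy ↦ by
      dsimp only
      rw [OpensChart.fderiv_apply₂ G hy v w u]
  have hD := differentiableAt_fderiv_of_contDiffAt_two hG2
  have hd : DifferentiableAt ℝ (fun y ↦ fderiv ℝ G y u v w) x :=
    ((hD.clm_apply (differentiableAt_const u)).clm_apply (differentiableAt_const v)).clm_apply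
      (differentiableAt_const w)
  refine HasFDerivAt.congr_of_eventuallyEq ?_ heq
  refine hd.hasFDerivAt.congr_fderiv ?_
  ext a
  rw [fderiv_apply₃ hD u v w a]
  rfl

/-- **The derivative of the Koszul form**: at a `C²` point,
`∂_X K(Z,Y,W)(x) = D²G(x)(X,Y)(Z,W) + D²G(x)(X,Z)(W,Y) − D²G(x)(X,W)(Y,Z)`. [folklore] -/
theorem fderiv_koszulForm_eq (hG2 : ContDiffAt ℝ 2 G x) (Z Y W X : E) :
    fderiv ℝ (fun y ↦ OpensChart.koszulForm G y Z Y W) x X =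
      fderiv ℝ (fderiv ℝ G) x X Y Z W + fderiv ℝ (fderiv ℝ G) x X Z W Y -
        fderiv ℝ (fderiv ℝ G) x X W Y Z := by
  have hD := differentiableAt_fderiv_of_contDiffAt_two hG2
  have hd3 : ∀ p q r : E, DifferentiableAt ℝ (fun y ↦ fderiv ℝ G y p q r) x := fun p q r ↦
    ((hD.clm_apply (differentiableAt_const p)).clm_apply (differentiableAt_const q)).clm_apply
      (differentiableAt_const r)
  have hfun : (fun y ↦ OpensChart.koszulForm G y Z Y W) =
      fun y ↦ fderiv ℝ G y Y Z W + fderiv ℝ G y Z W Y - fderiv ℝ G y W Y Z := by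
    funext y
    exact OpensChart.koszulForm_apply G y Z Y W
  rw [hfun, (((hd3 Y Z W).hasFDerivAt.fun_add (hd3 Z W Y).hasFDerivAt).fun_sub
    (hd3 W Y Z).hasFDerivAt).fderiv]
  simp only [_root_.sub_apply, _root_.add_apply, fderiv_apply₃ hD]

end Calculus

/-! ### The estimate in an orthonormal frame -/

section Frame

variable {E : Type*} [NormedAddCommGroup E] [InnerProductSpace ℝ E] [FiniteDimensional ℝ E]
  {ι : Type*} [Fintype ι] [DecidableEq ι] (b : OrthonormalBasis ι ℝ E)
  {G : E → E →L[ℝ] E →L[ℝ] ℝ} {x : E}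

omit [FiniteDimensional ℝ E] in
/-- The Gram matrix of the components in an orthonormal frame is `δ` plus the components of
`G x − δ`: `|𝒢ᵢⱼ − δᵢⱼ| ≤ ‖G x − δ‖`. [folklore] -/
theorem abs_gram_sub_one_le (x : E) (i j : ι) :
    |(Matrix.of fun i j ↦ G x (b i) (b j)) i j - (1 : Matrix ι ι ℝ) i j| ≤
      ‖G x - (innerSL ℝ : E →L[ℝ] E →L[ℝ] ℝ)‖ := by
  have hb : ∀ i, ‖b i‖ = 1 := fun i ↦ b.orthonormal.1 i
  have hδ : (1 : Matrix ι ι ℝ) i j = (innerSL ℝ : E →L[ℝ] E →L[ℝ] ℝ) (b i) (b j) := by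
    rw [Matrix.one_apply, innerSL_apply_apply, orthonormal_iff_ite.1 b.orthonormal i j]
  rw [Matrix.of_apply, hδ]
  have h := (G x - (innerSL ℝ : E →L[ℝ] E →L[ℝ] ℝ)).le_opNorm₂ (b i) (b j)
  rw [hb, hb, mul_one, mul_one, Real.norm_eq_abs] at h
  exact h

omit [FiniteDimensional ℝ E] [DecidableEq ι] in
/-- Components of `DG` in an orthonormal frame are bounded by `‖DG(x)‖`. [folklore] -/
theorem abs_fderiv_apply_le (x : E) (u v w : ι) :
    |fderiv ℝ G x (b u) (b v) (b w)| ≤ ‖fderiv ℝ G x‖ := by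
  have hb : ∀ i, ‖b i‖ = 1 := fun i ↦ b.orthonormal.1 i
  have h1 := (fderiv ℝ G x (b u)).le_opNorm₂ (b v) (b w)
  have h2 := (fderiv ℝ G x).le_opNorm (b u)
  rw [hb, hb, mul_one, mul_one, Real.norm_eq_abs] at h1
  rw [hb, mul_one] at h2
  exact h1.trans h2

omit [FiniteDimensional ℝ E] [DecidableEq ι] in
/-- Components of `D²G` in an orthonormal frame are bounded by `‖D²G(x)‖`. [folklore] -/
theorem abs_fderiv_fderiv_apply_le (x : E) (a u v w : ι) :
    |fderiv ℝ (fderiv ℝ G) x (b a) (b u) (b v) (b w)| ≤ ‖fderiv ℝ (fderiv ℝ G) x‖ := by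
  have hb : ∀ i, ‖b i‖ = 1 := fun i ↦ b.orthonormal.1 i
  have h1 := (fderiv ℝ (fderiv ℝ G) x (b a) (b u)).le_opNorm₂ (b v) (b w)
  have h2 := (fderiv ℝ (fderiv ℝ G) x).le_opNorm₂ (b a) (b u)
  rw [hb, hb, mul_one, mul_one, Real.norm_eq_abs] at h1
  rw [hb, hb, mul_one, mul_one] at h2
  exact h1.trans h2

omit [FiniteDimensional ℝ E] in
/-- **Linearisation of the scalar curvature, Koszul form.** Let `G` be `C²` at `x` with
`‖G x − δ‖ ≤ 1/(2 dim E)`. Then the coordinate expression of the scalar curvature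
(`OpensChart.scalarCurvature_eq_coord` in the orthonormal frame `b`) differs from its linear part
`∑ₖᵢ ½(∂ᵢ K(bₖ,bₖ,bᵢ) − ∂ₖ K(bₖ,bᵢ,bᵢ))` by at most
`m⁴ · 3 (2 m ‖G x − δ‖) (3 ‖D²G(x)‖) + m⁶ · 4 (3 ‖DG(x)‖)²` (`m = dim E`): the inverse Gram
matrix is within `2 m ‖G x − δ‖` of `δ` (`Matrix.abs_inv_sub_one_le`), the Koszul forms are bounded
by `3 ‖DG‖` and their derivatives by `3 ‖D²G‖`. Bartnik 1986, (4.3)–(4.4).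
[cite: Bartnik1986, §4, (4.3)–(4.4)] -/
theorem abs_scalarCoord_sub_linKoszul_le [Nonempty ι] (hG2 : ContDiffAt ℝ 2 G x)
    (hε : ‖G x - (innerSL ℝ : E →L[ℝ] E →L[ℝ] ℝ)‖ ≤ 1 / (2 * Fintype.card ι)) :
    |(∑ k, ∑ l, (Matrix.of fun i j ↦ G x (b i) (b j))⁻¹ l k *
        ∑ i, ∑ j, (Matrix.of fun i j ↦ G x (b i) (b j))⁻¹ j i *
          (2⁻¹ * (fderiv ℝ (fun y ↦ OpensChart.koszulForm G y (b l) (b k) (b j)) x (b i)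
              - fderiv ℝ (fun y ↦ OpensChart.koszulForm G y (b l) (b i) (b j)) x (b k))
            - ∑ a, ∑ c, (Matrix.of fun i j ↦ G x (b i) (b j))⁻¹ c a *
                (2⁻¹ * OpensChart.koszulForm G x (b j) (b i) (b c)) *
                (2⁻¹ * OpensChart.koszulForm G x (b l) (b k) (b a))
            + ∑ a, ∑ c, (Matrix.of fun i j ↦ G x (b i) (b j))⁻¹ c a *
                (2⁻¹ * OpensChart.koszulForm G x (b j) (b k) (b c)) *
                (2⁻¹ * OpensChart.koszulForm G x (b l) (b i) (b a))))
      - ∑ k, ∑ i, 2⁻¹ * (fderiv ℝ (fun y ↦ OpensChart.koszulForm G y (b k) (b k) (b i)) x (b i)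
          - fderiv ℝ (fun y ↦ OpensChart.koszulForm G y (b k) (b i) (b i)) x (b k))|
    ≤ (Fintype.card ι : ℝ) ^ 4 *
        (3 * (2 * Fintype.card ι * ‖G x - (innerSL ℝ : E →L[ℝ] E →L[ℝ] ℝ)‖) *
          (3 * ‖fderiv ℝ (fderiv ℝ G) x‖))
      + (Fintype.card ι : ℝ) ^ 6 * (4 * (3 * ‖fderiv ℝ G x‖) ^ 2) := by
  set ε := ‖G x - (innerSL ℝ : E →L[ℝ] E →L[ℝ] ℝ)‖ with hε_def
  have hε0 : 0 ≤ ε := norm_nonneg _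
  have hcard : (0 : ℝ) < Fintype.card ι := by exact_mod_cast Fintype.card_pos
  have hsmall : Fintype.card ι * ε ≤ 1 / 2 := by
    rw [le_div_iff₀ (by positivity)] at hε
    linarith
  -- the inverse Gram matrix
  have hinv := fun i j ↦ Matrix.abs_inv_sub_one_le (Matrix.of fun i j ↦ G x (b i) (b j)) hε0
    hsmall (fun i j ↦ abs_gram_sub_one_le b x i j) i j
  -- bounds for the Koszul forms and their derivatives
  have hK : ∀ a c d : ι, |OpensChart.koszulForm G x (b a) (b c) (b d)| ≤ 3 * ‖fderiv ℝ G x‖ := by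
    intro a c d
    rw [OpensChart.koszulForm_apply]
    have h1 := abs_fderiv_apply_le (G := G) b x c a d
    have h2 := abs_fderiv_apply_le (G := G) b x a d c
    have h3 := abs_fderiv_apply_le (G := G) b x d c a
    have := abs_add_le (fderiv ℝ G x (b c) (b a) (b d)) (fderiv ℝ G x (b a) (b d) (b c))
    have := abs_sub (fderiv ℝ G x (b c) (b a) (b d) + fderiv ℝ G x (b a) (b d) (b c))
      (fderiv ℝ G x (b d) (b c) (b a))
    linarith
  have hP : ∀ a c d e : ι,
      |fderiv ℝ (fun y ↦ OpensChart.koszulForm G y (b c) (b d) (b e)) x (b a)| ≤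
        3 * ‖fderiv ℝ (fderiv ℝ G) x‖ := by
    intro a c d e
    rw [fderiv_koszulForm_eq hG2]
    have h1 := abs_fderiv_fderiv_apply_le (G := G) b x a d c e
    have h2 := abs_fderiv_fderiv_apply_le (G := G) b x a c e d
    have h3 := abs_fderiv_fderiv_apply_le (G := G) b x a e d c
    have := abs_add_le (fderiv ℝ (fderiv ℝ G) x (b a) (b d) (b c) (b e))
      (fderiv ℝ (fderiv ℝ G) x (b a) (b c) (b e) (b d))
    have := abs_sub (fderiv ℝ (fderiv ℝ G) x (b a) (b d) (b c) (b e) +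
      fderiv ℝ (fderiv ℝ G) x (b a) (b c) (b e) (b d))
      (fderiv ℝ (fderiv ℝ G) x (b a) (b e) (b d) (b c))
    linarith
  have hη : 0 ≤ 2 * Fintype.card ι * ε := by positivity
  have hq : 0 ≤ 3 * ‖fderiv ℝ G x‖ := by positivity
  exact abs_curvatureSum_sub_linearSum_le ((Matrix.of fun i j ↦ G x (b i) (b j))⁻¹)
    (fun a c d e ↦ fderiv ℝ (fun y ↦ OpensChart.koszulForm G y (b c) (b d) (b e)) x (b a))
    (fun a c d ↦ OpensChart.koszulForm G x (b a) (b c) (b d)) hη hq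
    (fun i j ↦ (hinv i j).1) (fun i j ↦ (hinv i j).2) hP hK

omit [FiniteDimensional ℝ E] [DecidableEq ι] in
/-- **The linear part is `∑ᵢₖ (∂ᵢ∂ₖ Gᵢₖ − ∂ᵢ∂ᵢ Gₖₖ)`.** For `G` of class `C²` at `x` with symmetric
values (`G y v w = G y w v`), the Koszul-form linear part of the scalar curvature equals
`∑ᵢₖ (D²G(x)(bᵢ,bₖ)(bᵢ,bₖ) − D²G(x)(bᵢ,bᵢ)(bₖ,bₖ))` (symmetry of second derivatives and of `G`).
Bartnik 1986, (4.2)–(4.3). [cite: Bartnik1986, §4, (4.2)–(4.3)] -/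
theorem linKoszul_eq_sum (hG2 : ContDiffAt ℝ 2 G x) (hsymm : ∀ y v w, G y v w = G y w v) :
    ∑ k, ∑ i, 2⁻¹ * (fderiv ℝ (fun y ↦ OpensChart.koszulForm G y (b k) (b k) (b i)) x (b i)
        - fderiv ℝ (fun y ↦ OpensChart.koszulForm G y (b k) (b i) (b i)) x (b k)) =
      ∑ i, ∑ k, (fderiv ℝ (fderiv ℝ G) x (b i) (b k) (b i) (b k) -
        fderiv ℝ (fderiv ℝ G) x (b i) (b i) (b k) (b k)) := by
  -- symmetries of the second derivative
  have S1 : ∀ a u v w : E, fderiv ℝ (fderiv ℝ G) x a u v w = fderiv ℝ (fderiv ℝ G) x u a v w :=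
    fun a u v w ↦ by
    rw [(hG2.isSymmSndFDerivAt (by rw [minSmoothness_of_isRCLikeNormedField])).eq a u]
  have S2 : ∀ a u v w : E, fderiv ℝ (fderiv ℝ G) x a u v w = fderiv ℝ (fderiv ℝ G) x a u w v :=
    fun a u v w ↦ by
    rw [fderiv_fderiv_bilin_apply_eq hG2, fderiv_fderiv_bilin_apply_eq hG2]
    have : (fun z ↦ G z v w) = fun z ↦ G z w v := funext fun z ↦ hsymm z v w
    rw [this]
  set C := fderiv ℝ (fderiv ℝ G) x with hC
  have hterm : ∀ k i,
      2⁻¹ * (fderiv ℝ (fun y ↦ OpensChart.koszulForm G y (b k) (b k) (b i)) x (b i)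
        - fderiv ℝ (fun y ↦ OpensChart.koszulForm G y (b k) (b i) (b i)) x (b k)) =
      C (b i) (b k) (b i) (b k) - 2⁻¹ * C (b i) (b i) (b k) (b k) -
        2⁻¹ * C (b k) (b k) (b i) (b i) := by
    intro k i
    rw [fderiv_koszulForm_eq hG2, fderiv_koszulForm_eq hG2, ← hC]
    rw [S2 (b i) (b k) (b k) (b i), S1 (b k) (b i) (b k) (b i), S2 (b i) (b k) (b k) (b i),
      S1 (b k) (b i) (b i) (b k)]
    ring
  simp_rw [hterm]
  rw [Finset.sum_comm]
  have hswap : ∑ i, ∑ k, C (b k) (b k) (b i) (b i) = ∑ i, ∑ k, C (b i) (b i) (b k) (b k) :=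
    Finset.sum_comm
  simp only [Finset.sum_sub_distrib, ← Finset.mul_sum]
  rw [hswap]
  ring

/-! ### The ADM flux vector field and its divergence -/

omit [FiniteDimensional ℝ E] [DecidableEq ι] in
/-- **The derivative of the ADM flux field.** Let `V y = ∑ᵢ (∑ⱼ (∂ⱼ Gᵢⱼ − ∂ᵢ Gⱼⱼ)(y)) bᵢ` (the
ADM energy flux density field of the components `G` in the orthonormal frame `b`; given through
the representative hypothesis `hV`). At a `C²` point of `G`, `V` is differentiable with
`DV(x) a = ∑ᵢ (∑ⱼ (D²G(x)(a,bⱼ)(bᵢ,bⱼ) − D²G(x)(a,bᵢ)(bⱼ,bⱼ))) bᵢ`.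
Arnowitt–Deser–Misner 1962; Bartnik 1986, (4.2). [cite: Bartnik1986, §4, (4.2)] -/
theorem hasFDerivAt_admVec {V : E → E}
    (hV : ∀ y, V y = ∑ i, (∑ j, (fderiv ℝ (fun z ↦ G z (b i) (b j)) y (b j) -
      fderiv ℝ (fun z ↦ G z (b j) (b j)) y (b i))) • b i)
    (hG2 : ContDiffAt ℝ 2 G x) :
    HasFDerivAt V (∑ i, (∑ j, ((((fderiv ℝ (fderiv ℝ G) x).flip (b j)).flip (b i)).flip (b j) -
      (((fderiv ℝ (fderiv ℝ G) x).flip (b i)).flip (b j)).flip (b j))).smulRight (b i)) x := by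
  have hfun : V = fun y ↦ ∑ i, (∑ j, (fderiv ℝ (fun z ↦ G z (b i) (b j)) y (b j) -
      fderiv ℝ (fun z ↦ G z (b j) (b j)) y (b i))) • b i := funext hV
  subst hfun
  refine HasFDerivAt.fun_sum fun i _ ↦ ?_
  refine HasFDerivAt.smul_const ?_ (b i)
  refine HasFDerivAt.fun_sum fun j _ ↦ ?_
  exact (hasFDerivAt_fderiv_apply₂ hG2 (b j) (b i) (b j)).sub
    (hasFDerivAt_fderiv_apply₂ hG2 (b i) (b j) (b j))

omit [FiniteDimensional ℝ E] in
/-- **The divergence of the ADM flux field is the linearised scalar curvature**: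
`tr DV(x) = ∑ᵢₖ (D²G(x)(bᵢ,bₖ)(bᵢ,bₖ) − D²G(x)(bᵢ,bᵢ)(bₖ,bₖ)) = ∑ᵢₖ (∂ᵢ∂ₖ Gᵢₖ − ∂ᵢ∂ᵢ Gₖₖ)`.
Bartnik 1986, (4.2)–(4.3); Arnowitt–Deser–Misner 1962. [cite: Bartnik1986, §4, (4.2)–(4.3)] -/
theorem trace_fderiv_admVec {V : E → E}
    (hV : ∀ y, V y = ∑ i, (∑ j, (fderiv ℝ (fun z ↦ G z (b i) (b j)) y (b j) -
      fderiv ℝ (fun z ↦ G z (b j) (b j)) y (b i))) • b i)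
    (hG2 : ContDiffAt ℝ 2 G x) :
    LinearMap.trace ℝ E (fderiv ℝ V x : E →ₗ[ℝ] E) =
      ∑ i, ∑ k, (fderiv ℝ (fderiv ℝ G) x (b i) (b k) (b i) (b k) -
        fderiv ℝ (fderiv ℝ G) x (b i) (b i) (b k) (b k)) := by
  rw [(hasFDerivAt_admVec b hV hG2).fderiv, LinearMap.trace_eq_sum_inner _ b]
  refine Finset.sum_congr rfl fun a _ ↦ ?_
  have horth : ∀ i, ⟪b a, b i⟫ = if a = i then (1 : ℝ) else 0 := fun i ↦
    orthonormal_iff_ite.1 b.orthonormal a i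
  simp only [ContinuousLinearMap.coe_coe, _root_.sum_apply,
    ContinuousLinearMap.smulRight_apply, _root_.sub_apply, ContinuousLinearMap.flip_apply,
    inner_sum, inner_smul_right, horth, mul_ite, mul_one, mul_zero, Finset.sum_ite_eq,
    Finset.mem_univ, if_true]

omit [FiniteDimensional ℝ E] [DecidableEq ι] in
/-- The ADM flux field of `C^{m+2}` components is `C^{m}`… more precisely: if `G` is `C^{n}` at
`x` with `m + 1 ≤ n` then `V` is `C^{m}` at `x`. [folklore] -/
theorem contDiffAt_admVec {V : E → E}
    (hV : ∀ y, V y = ∑ i, (∑ j, (fderiv ℝ (fun z ↦ G z (b i) (b j)) y (b j) -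
      fderiv ℝ (fun z ↦ G z (b j) (b j)) y (b i))) • b i)
    {m n : ℕ∞ω} (hG : ContDiffAt ℝ n G x) (hmn : m + 1 ≤ n) : ContDiffAt ℝ m V x := by
  have hfun : V = fun y ↦ ∑ i, (∑ j, (fderiv ℝ (fun z ↦ G z (b i) (b j)) y (b j) -
      fderiv ℝ (fun z ↦ G z (b j) (b j)) y (b i))) • b i := funext hV
  subst hfun
  have hscal : ∀ v w : E, ContDiffAt ℝ n (fun z ↦ G z v w) x := fun v w ↦
    (hG.clm_apply contDiffAt_const).clm_apply contDiffAt_const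
  have hd : ∀ u v w : E, ContDiffAt ℝ m (fun y ↦ fderiv ℝ (fun z ↦ G z v w) y u) x :=
    fun u v w ↦ ((hscal v w).fderiv_right hmn).clm_apply contDiffAt_const
  refine ContDiffAt.sum fun i _ ↦ ?_
  refine ContDiffAt.smul ?_ contDiffAt_const
  exact ContDiffAt.sum fun j _ ↦ (hd (b j) (b i) (b j)).sub (hd (b i) (b j) (b j))

end Frame

end Literature.Geometry.Lorentzian

end
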